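import Literature.Geometry.Lorentzian.CausalFutureProofs
import Literature.Geometry.Lorentzian.CausalityClosedProofs
import Literature.Geometry.Lorentzian.NearKerrLeafMinkowskiFakeHoles
import Summits.FinalStateConjecture.FinalStateConjecture.Theorems.BartnikGapSettlingBondiBartnikRigidityDirectMethodDefs
import HarnessLib

/-!
# Causal bookkeeping of the Killing domain and of Kerr boxes — line `direct-method-on-the-cone`
# (crux `BondiBartnikRigidity`, stmt-FinalStateConjecture-10807), wave 1 of lead a2 (worker K2)

Sorry-free helper lemmas over the line's vocabulary (`Theorems/…DirectMethodDefs.lean`) used by the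
checked reduction of K2 (`…StationaryKerrCollarRoute.lean`) and by the skeleton:

* `futureDomain_subset_causalFuture` — `D⁺(W) ⊆ J⁺(W)` for the FAITHFUL future domain of dependence
  (through every point passes an endless timelike curve, `exists_isEndlessTimelikeCurve_through`;
  Hawking–Ellis 1973, §6.5), and `killingDomain_subset_causalFuture` — `D⁺(C ∪ N_out) ⊆ J⁺(C)`, the
  PLACEMENT inclusion through which K1's shell box and K2's roof charts are moved into `J⁺(C)`
  (`IsNearModelBox.of_interior_killingDomain`); the registered bookkeeping sub-goal
  `stub_killingDomainSubsetCausalFuture` is its closed universe-`0` form;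
* degenerate boxes: `coordBox_eq_empty_of_le`, `isNearModelBox_of_coordBox_eq_empty` (with
  `Minkowski.supCkENorm_empty`),
  `exists_isNearModelBox_of_degenerate` (an EMPTY box `{τ₁ < t < τ₂, r₁ < r < r₂}`, `τ₂ ≤ τ₁ ∨ r₂ ≤ r₁`,
  is an `(ε, k)`-box for every chart — the only cheap corner of K2/K3/K4, recorded so that their proofs
  reduce to `0 < T ∧ M < R + 1`);
* `IsNearModelBox.of_exact_order_zero` — the regularity index of an EXACT box is idle (an order-`0`
  exact deviation on an open set vanishes identically there, hence so do all iterated derivatives);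
  `isNearModelBox_of_exactOn` — an exact chart on a set restricts to an exact box of every order on any
  open sub-box; openness of star-background boxes (`isOpen_coordBox`,
  `isOpen_image_val_coordBox_of_eq_starBackground`, continuity of the star background's time/radius).

References: Hawking–Ellis 1973, §6.5 (domains of dependence) [HawkingEllis1973CUP]; DHRT
arXiv:2104.08222, §1 (chart/deviation vocabulary) [DafermosHolzegelRodnianskiTaylor2021];
Dafermos–Rodnianski arXiv:0811.0354, §5.1 (Kerr-star charts) [DafermosRodnianski2008].
-/

noncomputable section

-- D-0017: single-problem summit, `Summit.<S>.<S>.…` by design (cf. lakefile `weak.linter.dupNamespace`).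
set_option linter.dupNamespace false

open Set Filter Function Topology TopologicalSpace
open Literature.Geometry.Lorentzian
open scoped Manifold ContDiff Topology ENNReal

namespace Summit.FinalStateConjecture.FinalStateConjecture.Theorems.BondiBartnikRigidity.DirectMethod

universe u

/-- `D⁺(W) ⊆ J⁺(W)`: through every point passes a past-endless timelike curve. -/
theorem futureDomain_subset_causalFuture (𝒮 : Spacetime.{u} 4) (W : Set 𝒮.carrier) :
    futureDomain 𝒮 W ⊆ 𝒮.metric.causalFuture 𝒮.timeOrientation W := by
  intro q hq
  have hn2 : (2 : ℕ∞ω) ≤ ((⊤ : ℕ∞) : ℕ∞ω) := WithTop.coe_le_coe.mpr le_top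
  obtain ⟨Δ, Dm, hΔ, h0, hΔ0⟩ :=
    LorentzianMetric.exists_isEndlessTimelikeCurve_through (g := 𝒮.metric) (τ := 𝒮.timeOrientation)
      hn2 q
  obtain ⟨t, ht, ht0, hW⟩ := hq Δ Dm hΔ.1 hΔ.2.1.isFutureCausalCurveOn hΔ.2.2.2 0 h0 hΔ0
  rcases ht0.eq_or_lt with rfl | hlt
  · exact LorentzianMetric.subset_causalFuture _ _ _ (hΔ0 ▸ hW)
  · refine Or.inr ⟨Δ t, hW, Δ, t, 0, hlt, ?_, rfl, hΔ0⟩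
    exact hΔ.2.1.isFutureCausalCurveOn.mono (hΔ.1.out ht h0)

/-- `J⁺(D⁺(W)) ⊆ J⁺(W)`… more precisely `D⁺(W) ⊆ J⁺(W')` whenever `W ⊆ J⁺(W')`. -/
theorem futureDomain_subset_causalFuture_of_subset (𝒮 : Spacetime.{u} 4) {W W' : Set 𝒮.carrier}
    (h : W ⊆ 𝒮.metric.causalFuture 𝒮.timeOrientation W') :
    futureDomain 𝒮 W ⊆ 𝒮.metric.causalFuture 𝒮.timeOrientation W' := by
  have hn2 : (2 : ℕ∞ω) ≤ ((⊤ : ℕ∞) : ℕ∞ω) := WithTop.coe_le_coe.mpr le_top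
  refine (futureDomain_subset_causalFuture 𝒮 W).trans ?_
  refine (LorentzianMetric.causalFuture_mono h).trans ?_
  rw [LorentzianMetric.causalFuture_causalFuture_eq hn2]

variable {X : Type u} [TopologicalSpace X] [ChartedSpace E3 X] [IsManifold (𝓡 3) ∞ X]
  [ConnectedSpace X] {D : InitialDataSet (𝓡 3) X}

/-- The shell image lies in the core. -/
theorem image_shellSlab_subset_collarCore (𝒱 : VacuumCauchyDevelopment D) (M : Fin 1 → ℝ)
    (p : 𝒱.carrier) (B : Fin 1 → ModelBackground) (Φ : ∀ i, (B i).domain → 𝒱.carrier) :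
    Φ 0 '' shellSlab (B 0) (M 0) ⊆ collarCore M p B Φ :=
  (image_mono (shellSlab_subset_truncTimeSlab (B 0) (M 0))).trans
    (image_truncTimeSlab_subset_collarCore M p B Φ 0)

/-- `C ∪ N_out ⊆ J⁺(C)`. -/
theorem collarCore_union_roof_subset_causalFuture (𝒱 : VacuumCauchyDevelopment D)
    (M : Fin 1 → ℝ) (p : 𝒱.carrier) (B : Fin 1 → ModelBackground)
    (Φ : ∀ i, (B i).domain → 𝒱.carrier) :
    collarCore M p B Φ ∪
        (frontier (𝒱.metric.causalFuture 𝒱.timeOrientation (collarCore M p B Φ)) ∩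
          𝒱.metric.causalFuture 𝒱.timeOrientation (Φ 0 '' shellSlab (B 0) (M 0))) ⊆
      𝒱.metric.causalFuture 𝒱.timeOrientation (collarCore M p B Φ) :=
  union_subset (LorentzianMetric.subset_causalFuture _ _ _)
    (inter_subset_right.trans
      (LorentzianMetric.causalFuture_mono (image_shellSlab_subset_collarCore 𝒱 M p B Φ)))

/-- **`killingDomain ⊆ J⁺(C)`**: `D⁺(C ∪ N_out) ⊆ J⁺(C ∪ N_out) ⊆ J⁺(J⁺(C)) = J⁺(C)`. -/
theorem killingDomain_subset_causalFuture (𝒱 : VacuumCauchyDevelopment D) (M : Fin 1 → ℝ)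
    (p : 𝒱.carrier) (B : Fin 1 → ModelBackground) (Φ : ∀ i, (B i).domain → 𝒱.carrier) :
    killingDomain 𝒱 M p B Φ ⊆ 𝒱.metric.causalFuture 𝒱.timeOrientation (collarCore M p B Φ) :=
  futureDomain_subset_causalFuture_of_subset 𝒱.toSpacetime
    (collarCore_union_roof_subset_causalFuture 𝒱 M p B Φ)

/-- A box inside `interior (killingDomain …)` is a box inside `J⁺(C)`. -/
theorem IsNearModelBox.of_interior_killingDomain {𝒱 : VacuumCauchyDevelopment D}
    {M : Fin 1 → ℝ} {p : 𝒱.carrier} {B : Fin 1 → ModelBackground}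
    {Φ : ∀ i, (B i).domain → 𝒱.carrier} {B' : ModelBackground} {k : ℕ} {ε : ℝ≥0∞}
    {τ₁ τ₂ r₁ r₂ : ℝ} {Ψ : B'.domain → 𝒱.carrier}
    (h : IsNearModelBox 𝒱.toSpacetime B' k ε τ₁ τ₂ r₁ r₂ (interior (killingDomain 𝒱 M p B Φ)) Ψ) :
    IsNearModelBox 𝒱.toSpacetime B' k ε τ₁ τ₂ r₁ r₂
      (𝒱.metric.causalFuture 𝒱.timeOrientation (collarCore M p B Φ)) Ψ :=
  h.mono_set (interior_subset.trans (killingDomain_subset_causalFuture 𝒱 M p B Φ))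

section Boxes

variable {𝒮 : Spacetime.{u} 4} {B : ModelBackground} {k : ℕ} {ε : ℝ≥0∞} {τ₁ τ₂ r₁ r₂ : ℝ}
  {J : Set 𝒮.carrier} {Ψ : B.domain → 𝒮.carrier}

/-- A coordinate box with `τ₂ ≤ τ₁` or `r₂ ≤ r₁` is empty. -/
theorem coordBox_eq_empty_of_le (B : ModelBackground) {τ₁ τ₂ r₁ r₂ : ℝ} (h : τ₂ ≤ τ₁ ∨ r₂ ≤ r₁) :
    coordBox B τ₁ τ₂ r₁ r₂ = ∅ := by
  ext x
  simp only [mem_coordBox, mem_empty_iff_false, iff_false, not_and, not_lt]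
  intro h₁ h₂ h₃
  rcases h with h | h
  · exact absurd (h₁.trans h₂) (not_lt.2 h)
  · exact h.trans h₃.le

/-- An EMPTY box is an `(ε, k)`-box for every chart (all four clauses are vacuous). -/
theorem isNearModelBox_of_coordBox_eq_empty (h : coordBox B τ₁ τ₂ r₁ r₂ = ∅)
    (Ψ : B.domain → 𝒮.carrier) : IsNearModelBox 𝒮 B k ε τ₁ τ₂ r₁ r₂ J Ψ := by
  refine ⟨by rw [h]; exact contMDiffOn_empty, ?_, by rw [h, image_empty]; exact empty_subset _, ?_⟩
  · haveI : IsEmpty (coordBox B τ₁ τ₂ r₁ r₂) := by rw [h]; infer_instance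
    exact .of_continuous_injective_isOpenMap continuous_of_discreteTopology
      (fun a ↦ isEmptyElim a) (fun s _ ↦ by rw [Set.eq_empty_of_isEmpty s, image_empty]; exact isOpen_empty)
  · rw [h, image_empty, Minkowski.supCkENorm_empty]
    exact zero_le

/-- DEGENERATE INSTANCES of the stub's conclusion: for `T ≤ 0` or `R + 1 ≤ M₀` the box
`{τ < t < τ + T, M₀ < r < R + 1}` is empty and any chart will do. -/
theorem exists_isNearModelBox_of_degenerate (𝒮 : Spacetime.{u} 4) (B : ModelBackground) (k : ℕ)
    (J : Set 𝒮.carrier) {M₀ R T : ℝ} (h : T ≤ 0 ∨ R + 1 ≤ M₀) (Ψ : B.domain → 𝒮.carrier) :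
    ∃ (τ : ℝ) (Ψ : B.domain → 𝒮.carrier), IsNearModelBox 𝒮 B k 0 τ (τ + T) M₀ (R + 1) J Ψ :=
  ⟨0, Ψ, isNearModelBox_of_coordBox_eq_empty
    (coordBox_eq_empty_of_le B (h.imp (fun hT ↦ by linarith) id)) Ψ⟩

/-- **Exactness at order `0` on an OPEN box is exactness at every order**: if the box is open in
`E4` (e.g. for a background with continuous time and radius functions) and the deviation vanishes
on it, all its iterated derivatives vanish there (they are local). So the regularity index `k` of an
EXACT (`ε = 0`) box is idle. -/
theorem IsNearModelBox.of_exact_order_zero (hopen : IsOpen (Subtype.val '' coordBox B τ₁ τ₂ r₁ r₂))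
    (h : IsNearModelBox 𝒮 B 0 0 τ₁ τ₂ r₁ r₂ J Ψ) (k : ℕ) : IsNearModelBox 𝒮 B k 0 τ₁ τ₂ r₁ r₂ J Ψ := by
  refine ⟨h.1, h.2.1, h.2.2.1, ?_⟩
  set S := Subtype.val '' coordBox B τ₁ τ₂ r₁ r₂ with hS
  set f := 𝒮.deviationExtend B Ψ with hf
  -- order `0`: `f` vanishes on `S`
  have h0 : ∀ x ∈ S, f x = 0 := by
    intro x hx
    have hle := (enorm_iteratedFDeriv_le_supCkENorm (k := 0) le_rfl hx f).trans h.2.2.2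
    have h' : iteratedFDeriv ℝ 0 f x = 0 := by
      have := le_antisymm hle zero_le
      rwa [enorm_eq_zero] at this
    calc f x = iteratedFDeriv ℝ 0 f x Fin.elim0 := (iteratedFDeriv_zero_apply _).symm
      _ = 0 := by rw [h']; rfl
  -- locality: on the open set `S`, `f` agrees with `0` near every point
  refine iSup₂_le fun m _ ↦ iSup₂_le fun x hx ↦ ?_
  have hfx : f =ᶠ[𝓝 x] (0 : E4 → E4 →L[ℝ] E4 →L[ℝ] ℝ) :=
    Filter.eventuallyEq_of_mem (hopen.mem_nhds hx) fun y hy ↦ h0 y hy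
  have := (hfx.iteratedFDeriv ℝ m).eq_of_nhds
  rw [this, iteratedFDeriv_zero, Pi.zero_apply, enorm_zero]

end Boxes

/-! ### Openness of coordinate boxes of backgrounds with continuous time and radius -/

section OpenBoxes

variable {𝒮 : Spacetime.{u} 4} {B : ModelBackground} {τ₁ τ₂ r₁ r₂ : ℝ}

/-- A coordinate box of a background with continuous time and radius functions is open in the
domain. -/
theorem isOpen_coordBox (ht : Continuous B.time) (hr : Continuous B.radius) (τ₁ τ₂ r₁ r₂ : ℝ) :
    IsOpen (coordBox B τ₁ τ₂ r₁ r₂) := by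
  have h1 : IsOpen ((fun x : B.domain ↦ B.time x.1) ⁻¹' Ioo τ₁ τ₂) :=
    isOpen_Ioo.preimage (ht.comp continuous_subtype_val)
  have h2 : IsOpen ((fun x : B.domain ↦ B.radius x.1) ⁻¹' Ioo r₁ r₂) :=
    isOpen_Ioo.preimage (hr.comp continuous_subtype_val)
  convert h1.inter h2 using 1
  ext x
  simp only [mem_coordBox, mem_inter_iff, mem_preimage, mem_Ioo]
  tauto

/-- … and its image in `E4` is open. -/
theorem isOpen_image_val_coordBox (ht : Continuous B.time) (hr : Continuous B.radius)
    (τ₁ τ₂ r₁ r₂ : ℝ) : IsOpen (Subtype.val '' coordBox B τ₁ τ₂ r₁ r₂) :=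
  B.domain.isOpen.isOpenMap_subtype_val _ (isOpen_coordBox ht hr τ₁ τ₂ r₁ r₂)

/-- The time function of the boosted Kerr star background is continuous. -/
theorem continuous_time_starBackground (Λ : lorentzGroup) (c : E4) (M a : ℝ) (r : E4 → ℝ) :
    Continuous (starBackground Λ c M a r).time :=
  (PiLp.continuous_apply 2 _ 0).comp (continuous_poincareInv Λ c)

/-- The boosted Kerr–Schild radius is continuous. -/
theorem continuous_radius_starBackground (Λ : lorentzGroup) (c : E4) (M a : ℝ) :
    Continuous (starBackground Λ c M a (fun x => Kerr.radius a (poincareInv Λ c x))).radius :=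
  (Kerr.continuous_radius a).comp (continuous_poincareInv Λ c)

/-- Boxes of the collar background `B = starBackground Λ c M a (r_a ∘ (Λ, c)⁻¹)` are open in `E4`;
hence (`IsNearModelBox.of_exact_order_zero`) the regularity index of an EXACT box of a collar
background is idle. -/
theorem isOpen_image_val_coordBox_of_eq_starBackground {Λ : lorentzGroup} {c : E4} {M a : ℝ}
    (hB : B = starBackground Λ c M a (fun x => Kerr.radius a (poincareInv Λ c x)))
    (τ₁ τ₂ r₁ r₂ : ℝ) : IsOpen (Subtype.val '' coordBox B τ₁ τ₂ r₁ r₂) := by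
  subst hB
  exact isOpen_image_val_coordBox (continuous_time_starBackground Λ c M a _)
    (continuous_radius_starBackground Λ c M a) τ₁ τ₂ r₁ r₂

/-- **Restriction of an exact chart to a box.**  If `Ψ` is smooth on a set `Q ⊇ box`, an open
embedding of `Q`, maps `Q` into `J` and has vanishing deviation on `Q`, and the box is open (in the
domain and in `E4`), then `Ψ` is an exact `(0, k)`-box for every `k`. -/
theorem isNearModelBox_of_exactOn {Q : Set B.domain} {J : Set 𝒮.carrier} {Ψ : B.domain → 𝒮.carrier}
    (hs : ContMDiffOn 𝓘(ℝ, E4) (𝓡 4) ∞ Ψ Q) (he : IsOpenEmbedding (Q.restrict Ψ))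
    (hJ : Ψ '' Q ⊆ J) (hd : supCkENorm (Subtype.val '' Q) 0 (𝒮.deviationExtend B Ψ) ≤ 0)
    (hsub : coordBox B τ₁ τ₂ r₁ r₂ ⊆ Q) (hopen : IsOpen (coordBox B τ₁ τ₂ r₁ r₂))
    (hopenE : IsOpen (Subtype.val '' coordBox B τ₁ τ₂ r₁ r₂)) (k : ℕ) :
    IsNearModelBox 𝒮 B k 0 τ₁ τ₂ r₁ r₂ J Ψ := by
  refine IsNearModelBox.of_exact_order_zero hopenE ⟨hs.mono hsub, ?_, (image_mono hsub).trans hJ,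
    (supCkENorm_mono (image_mono hsub) 0 _).trans hd⟩ k
  have hincl : IsOpenEmbedding (Set.inclusion hsub) :=
    .inclusion hsub (continuous_subtype_val.isOpen_preimage _ hopen)
  exact he.comp hincl

end OpenBoxes


/-- **Registered bookkeeping sub-goal of the line** (`stub_killingDomainSubsetCausalFuture`): the
Killing domain `D⁺(C ∪ N_out)` of a single thick collar core lies in `J⁺(C)` (universe-`0` closed
form of `killingDomain_subset_causalFuture`; Hawking–Ellis 1973, §6.5). [cite: HawkingEllis1973CUP, §6.5] -/
theorem stub_killingDomainSubsetCausalFuture : ∀ (X : Type) [TopologicalSpace X] [ChartedSpace E3 X] [IsManifold (𝓡 3) ∞ X] [T2Space X] [SecondCountableTopology X] [ConnectedSpace X] (D : InitialDataSet (𝓡 3) X) (𝒱 : VacuumCauchyDevelopment D) (M : Fin 1 → ℝ) (p : 𝒱.carrier) (B : Fin 1 → ModelBackground) (Φ : ∀ i, (B i).domain → 𝒱.carrier), killingDomain 𝒱 M p B Φ ⊆ 𝒱.metric.causalFuture 𝒱.timeOrientation (collarCore M p B Φ) :=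
  fun _ _ _ _ _ _ _ _ 𝒱 M p B Φ ↦ killingDomain_subset_causalFuture 𝒱 M p B Φ

end Summit.FinalStateConjecture.FinalStateConjecture.Theorems.BondiBartnikRigidity.DirectMethod

end
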